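import Mathlib
import HarnessLib
import Summits.HubbardSuperconductivity.HubbardSuperconductivity.Theorems.KLProgrammeH10TwoPointLimitPerturbedFermiRadiusConvexity

/-!
# Route `KLProgramme` — K1/K3 (stmt-HubbardSuperconductivity-19938 / 20437), risk-register item 2 «Fermi-surface hypotheses on every
# admissible frame»: the POLAR CURVATURE of the perturbed Fermi curve is bounded below (BGM 2003 §1.2 (2.8a) for the moving curve)

Cell gate-hubbard-kl, seat p4 (C5a), g11.  Benfatto–Giuliani–Mastropietro 2003 §1.2 (2.8a) (field `convex` of `FermiRG.BGM2003.DispersionHyp`) asks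
`1/r(θ, e) = (u² + 2u′² − u u″)/(u′² + u²)^{3/2} ≥ c > 0` for the polar radius `u` of the level curves.  For a root selection `u` of the
perturbed curve `{ε₀ + δ = μ}` (`δ ∈ C²`, `|δ| ≤ κ₀`, `‖Dδ‖ ≤ κ₁ < Dt_min`, `‖D²δ‖ ≤ κ₂` on the closed square, `[μ − κ₀, μ + κ₀] ⊂ [a, b]`):

* **`pertDt_mul_curvatureNumerator_eq`** — the IDENTITY `(∂_tF + Dδ[e⃗_r])·(u² + 2u′² − u u″) = u·(2cos X_E X_E′² + 2cos Y_E Y_E′² + D²δ(p)[v,v])`: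
  the twice-differentiated level equation (`radial_second_deriv_identity`) combined with the once-differentiated one (`deriv_of_isRoot`,
  `∂_θF(θ,u) = −2u(sin X_E sin θ − sin Y_E cos θ)`) — the numerator of the polar curvature is the Hessian of `ε₀ + δ` along the velocity, times
  `u/(∇ε·e⃗_r)`;
* **`curvatureNumerator_ge`** — hence `u² + 2u′² − u u″ ≥ u_min·(2h_E − κ₂ S_E²)/(4 + κ₁)`, `h_E` = the strict-convexity constant of
  `hess_perturbed_ge`, `S_E` = the speed bound of `abs_VXE_le`;
* `speed_sq_le` — `u′² + u² = X_E′² + Y_E′² ≤ 2 S_E²`;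
* **`polarCurvature_perturbed_ge`** — `(u² + 2u′² − u u″)/(√(u′² + u²))³ ≥ u_min·(2h_E − κ₂S_E²)/((4 + κ₁)·(2S_E)³)` whenever `2h_E − κ₂S_E² ≥ 0`.

Everything is PROVED; no definitions, no named facts.  References: BGM 2003 §1.2 (2.8a), App. 7.1 (A1.7) [cite: BenfattoGiulianiMastropietro2003];
BGM 2006 §2.4 Lemma 2.1 (2.41) [cite: BenfattoGiulianiMastropietro2006].
-/

noncomputable section

namespace Summit.HubbardSuperconductivity.HubbardSuperconductivity.Theorems.PerturbedFermiCurve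

set_option linter.dupNamespace false -- summit = problem name (single-conjunct summit), D-0017

open Real Set
open Literature.MathematicalPhysics.QuantumLattice Literature.MathematicalPhysics.QuantumLattice.BandSectorCounting

/-- `∂_θF(θ, u θ) = −2u(sin X_E sin θ − sin Y_E cos θ)`. [folklore] -/
theorem rayDispersionDθ_eq_XE (u : ℝ → ℝ) (θ : ℝ) :
    rayDispersionDθ θ (u θ) = -(2 * u θ * (Real.sin (XE u θ) * Real.sin θ - Real.sin (YE u θ) * Real.cos θ)) := by
  simp only [XE, YE, rayDispersionDθ]; ring

/-- `u′² + u² = X_E′² + Y_E′²` (the velocity in the orthonormal frame `(e⃗_r, e⃗_t)`). [folklore] -/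
theorem deriv_sq_add_sq_eq_VXE (u : ℝ → ℝ) (θ : ℝ) : deriv u θ ^ 2 + u θ ^ 2 = VXE u θ ^ 2 + VYE u θ ^ 2 := by
  simp only [VXE, VYE]
  nlinarith [Real.sin_sq_add_cos_sq θ]

section Curvature

variable {a b : ℝ} (B : BandBounds a b) {δ : (Fin 2 → ℝ) → ℝ} (hδs : ContDiff ℝ 2 δ)
  {κ₀ κ₁ κ₂ μ : ℝ} (hδ : ∀ k : Fin 2 → ℝ, (∀ i, |k i| ≤ π) → |δ k| ≤ κ₀) (hlo : a ≤ μ - κ₀) (hhi : μ + κ₀ ≤ b)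
  (hκ : ∀ k : Fin 2 → ℝ, (∀ i, |k i| ≤ π) → ‖fderiv ℝ δ k‖ ≤ κ₁) (hκ₁ : κ₁ < B.Dtmin)
  (hκ₂ : ∀ k : Fin 2 → ℝ, (∀ i, |k i| ≤ π) → ‖fderiv ℝ (fderiv ℝ δ) k‖ ≤ κ₂)
  {u : ℝ → ℝ} (hu : ∀ θ, IsBandFermiRadius (μ - δ (u θ • dir θ)) θ (u θ))
include B hδs hδ hlo hhi hκ hκ₁ hu

/-- **The curvature identity of the perturbed curve**:
`(∂_tF(θ,u) + Dδ(p)[dir θ])·(u² + 2u′² − u·u″) = u·(2cos X_E X_E′² + 2cos Y_E Y_E′² + D²δ(p)[v,v])`, `p = u·dir θ`, `v = (X_E′, Y_E′)`.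
[cite: BenfattoGiulianiMastropietro2003, §7.1 (A1.7)] -/
theorem pertDt_mul_curvatureNumerator_eq (θ : ℝ) :
    (rayDispersionDt θ (u θ) + fderiv ℝ δ (u θ • dir θ) (dir θ)) * (u θ ^ 2 + 2 * deriv u θ ^ 2 - u θ * deriv (deriv u) θ) =
      u θ * (2 * Real.cos (XE u θ) * VXE u θ ^ 2 + 2 * Real.cos (YE u θ) * VYE u θ ^ 2 +
        fderiv ℝ (fderiv ℝ δ) (u θ • dir θ) ![VXE u θ, VYE u θ] ![VXE u θ, VYE u θ]) := by
  have h2ne : (2 : WithTop ℕ∞) ≠ 0 := by norm_num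
  have hu2 : ContDiff ℝ 2 u := contDiff_of_isRoot B hδs h2ne hδ hlo hhi hκ hκ₁ hu
  have hroot : ∀ θ, sqDispersion (u θ • dir θ) + δ (u θ • dir θ) = μ := fun θ => by
    have h := (hu θ).2
    simp only [rayDispersion] at h
    linarith
  have h2 := radial_second_deriv_identity hδs hu2 hroot θ
  have h1 := deriv_of_isRoot B hδs h2ne hδ hlo hhi hκ hκ₁ hu θ
  have hα := pertDt_pos B hδ hlo hhi hκ hκ₁ hu θ
  set α := rayDispersionDt θ (u θ) + fderiv ℝ δ (u θ • dir θ) (dir θ) with hαdef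
  rw [rayDispersionDθ_eq_XE, map_smul, smul_eq_mul, eq_div_iff hα.ne'] at h1
  set σ₁ := Real.sin (XE u θ) * Real.sin θ - Real.sin (YE u θ) * Real.cos θ with hσ₁
  set Dt := fderiv ℝ δ (u θ • dir θ) (dir (θ + π / 2)) with hDt
  -- `α·u′ = 2uσ₁ − u·Dδ[e_t]` and `α·u″ = −H + 4u′σ₁ + u·α − 2u′·Dδ[e_t]`
  have hαu : rayDispersionDt θ (u θ) + fderiv ℝ δ (u θ • dir θ) (dir θ) = α := rfl
  have key : α * (2 * deriv u θ ^ 2) = deriv u θ * (4 * u θ * σ₁) - 2 * deriv u θ * (u θ * Dt) := by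
    have h1' : deriv u θ * α = 2 * u θ * σ₁ - u θ * Dt := by linarith
    linear_combination (2 * deriv u θ) * h1' 
  have h2' : α * (u θ * deriv (deriv u) θ) = u θ * (α * deriv (deriv u) θ) := by ring
  rw [h2] at h2'
  have hsplit : u θ * rayDispersionDt θ (u θ) + u θ * fderiv ℝ δ (u θ • dir θ) (dir θ) = u θ * α := by rw [← hαu]; ring
  linear_combination key - h2' - u θ * hsplit

include hκ₂

/-- **Lower bound on the curvature numerator**: `u² + 2u′² − u u″ ≥ u_min·(2h_E − κ₂ S_E²)/(4 + κ₁)` whenever `2h_E − κ₂S_E² ≥ 0`, where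
`h_E = h_min − 4κ₁C_V(S_E + s_max)` (`hess_perturbed_ge`) and `S_E = s_max + κ₁(π√2 + 2s_max)/(Dt_min − κ₁)` (`abs_VXE_le`).
[cite: BenfattoGiulianiMastropietro2003, §1.2 (2.8a)] -/
theorem curvatureNumerator_ge (θ : ℝ)
    (hpos : 0 ≤ 2 * (B.hmin - 4 * (κ₁ * (π * Real.sqrt 2 + 2 * B.smax) / (B.Dtmin - κ₁)) *
        ((B.smax + κ₁ * (π * Real.sqrt 2 + 2 * B.smax) / (B.Dtmin - κ₁)) + B.smax)) -
        κ₂ * (B.smax + κ₁ * (π * Real.sqrt 2 + 2 * B.smax) / (B.Dtmin - κ₁)) ^ 2) :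
    B.umin * (2 * (B.hmin - 4 * (κ₁ * (π * Real.sqrt 2 + 2 * B.smax) / (B.Dtmin - κ₁)) *
        ((B.smax + κ₁ * (π * Real.sqrt 2 + 2 * B.smax) / (B.Dtmin - κ₁)) + B.smax)) -
        κ₂ * (B.smax + κ₁ * (π * Real.sqrt 2 + 2 * B.smax) / (B.Dtmin - κ₁)) ^ 2) / (4 + κ₁) ≤
      u θ ^ 2 + 2 * deriv u θ ^ 2 - u θ * deriv (deriv u) θ := by
  have h2ne : (2 : WithTop ℕ∞) ≠ 0 := by norm_num
  set hE := B.hmin - 4 * (κ₁ * (π * Real.sqrt 2 + 2 * B.smax) / (B.Dtmin - κ₁)) *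
        ((B.smax + κ₁ * (π * Real.sqrt 2 + 2 * B.smax) / (B.Dtmin - κ₁)) + B.smax) with hhE
  set SE := B.smax + κ₁ * (π * Real.sqrt 2 + 2 * B.smax) / (B.Dtmin - κ₁) with hSE
  have hsq := abs_apply_le_pi_of_isBandFermiRadius (hu θ)
  have hid := pertDt_mul_curvatureNumerator_eq B hδs hδ hlo hhi hκ hκ₁ hu θ
  have hα := pertDt_pos B hδ hlo hhi hκ hκ₁ hu θ
  set α := rayDispersionDt θ (u θ) + fderiv ℝ δ (u θ • dir θ) (dir θ) with hαdef
  set N := u θ ^ 2 + 2 * deriv u θ ^ 2 - u θ * deriv (deriv u) θ with hN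
  -- `α ≤ 4 + κ₁`
  have hα4 : α ≤ 4 + κ₁ := by
    have h1 := (abs_le.1 (abs_rayDispersionDt_le_four θ (u θ))).2
    have h2 := (abs_le.1 (abs_fderiv_dir_le (hκ _ hsq) θ)).2
    linarith
  have hκ₁0 : 0 ≤ κ₁ := le_trans (norm_nonneg _) (hκ _ hsq)
  -- the Hessian part `≥ 2h_E − κ₂S_E²`
  have hhess := hess_perturbed_ge B hδs hδ hlo hhi hκ hκ₁ hu θ
  obtain ⟨hvx, hvy⟩ := abs_VXE_le B hδs h2ne hδ hlo hhi hκ hκ₁ hu θ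
  have hSE0 : 0 ≤ SE := (abs_nonneg _).trans hvx
  have hD2 : |fderiv ℝ (fderiv ℝ δ) (u θ • dir θ) ![VXE u θ, VYE u θ] ![VXE u θ, VYE u θ]| ≤ κ₂ * SE ^ 2 := by
    have h := abs_fderiv_fderiv_le (hκ₂ _ hsq) ![VXE u θ, VYE u θ] ![VXE u θ, VYE u θ]
    have hv : ‖(![VXE u θ, VYE u θ] : Fin 2 → ℝ)‖ ≤ SE := norm_vec2_le hSE0 hvx hvy
    have hκ₂0 : 0 ≤ κ₂ := (norm_nonneg (fderiv ℝ (fderiv ℝ δ) (u θ • dir θ))).trans (hκ₂ _ hsq)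
    calc _ ≤ κ₂ * ‖(![VXE u θ, VYE u θ] : Fin 2 → ℝ)‖ * ‖(![VXE u θ, VYE u θ] : Fin 2 → ℝ)‖ := h
      _ ≤ κ₂ * SE * SE := mul_le_mul (mul_le_mul_of_nonneg_left hv hκ₂0) hv (norm_nonneg _) (by positivity)
      _ = κ₂ * SE ^ 2 := by ring
  have hH : 2 * hE - κ₂ * SE ^ 2 ≤ 2 * Real.cos (XE u θ) * VXE u θ ^ 2 + 2 * Real.cos (YE u θ) * VYE u θ ^ 2 +
      fderiv ℝ (fderiv ℝ δ) (u θ • dir θ) ![VXE u θ, VYE u θ] ![VXE u θ, VYE u θ] := by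
    have h := neg_abs_le (fderiv ℝ (fderiv ℝ δ) (u θ • dir θ) ![VXE u θ, VYE u θ] ![VXE u θ, VYE u θ])
    linarith
  -- `u ≥ u_min`, and the identity
  have humin : B.umin ≤ u θ := umin_le_of_shifted B hδ hlo hhi (hu θ)
  have hum0 : 0 < B.umin := B.umin_pos
  have hNα : B.umin * (2 * hE - κ₂ * SE ^ 2) ≤ α * N := by
    rw [hid]
    exact mul_le_mul humin hH hpos (hum0.le.trans humin)
  have hN0 : 0 ≤ N := by
    by_contra hneg
    have : α * N < 0 := mul_neg_of_pos_of_neg hα (lt_of_not_ge hneg)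
    have : 0 ≤ B.umin * (2 * hE - κ₂ * SE ^ 2) := mul_nonneg hum0.le hpos
    linarith
  rw [div_le_iff₀ (by linarith)]
  calc B.umin * (2 * hE - κ₂ * SE ^ 2) ≤ α * N := hNα
    _ ≤ (4 + κ₁) * N := mul_le_mul_of_nonneg_right hα4 hN0
    _ = N * (4 + κ₁) := mul_comm _ _

omit hκ₂ in
/-- **Speed bound**: `u′² + u² ≤ 2 S_E²`. [folklore] -/
theorem deriv_sq_add_sq_le (θ : ℝ) :
    deriv u θ ^ 2 + u θ ^ 2 ≤ 2 * (B.smax + κ₁ * (π * Real.sqrt 2 + 2 * B.smax) / (B.Dtmin - κ₁)) ^ 2 := by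
  have h2ne : (2 : WithTop ℕ∞) ≠ 0 := by norm_num
  obtain ⟨hvx, hvy⟩ := abs_VXE_le B hδs h2ne hδ hlo hhi hκ hκ₁ hu θ
  rw [deriv_sq_add_sq_eq_VXE]
  have h1 := sq_le_sq' (abs_le.1 hvx).1 (abs_le.1 hvx).2
  have h2 := sq_le_sq' (abs_le.1 hvy).1 (abs_le.1 hvy).2
  linarith

/-- **The polar curvature of the perturbed curve is bounded below** (BGM 2003 (2.8a) on the moving curve):
`(u² + 2u′² − u u″)/(√(u′² + u²))³ ≥ u_min(2h_E − κ₂S_E²)/((4 + κ₁)(2S_E)³)` whenever `2h_E − κ₂S_E² ≥ 0`.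
[cite: BenfattoGiulianiMastropietro2003, §1.2 (2.8a)] -/
theorem polarCurvature_perturbed_ge (θ : ℝ)
    (hpos : 0 ≤ 2 * (B.hmin - 4 * (κ₁ * (π * Real.sqrt 2 + 2 * B.smax) / (B.Dtmin - κ₁)) *
        ((B.smax + κ₁ * (π * Real.sqrt 2 + 2 * B.smax) / (B.Dtmin - κ₁)) + B.smax)) -
        κ₂ * (B.smax + κ₁ * (π * Real.sqrt 2 + 2 * B.smax) / (B.Dtmin - κ₁)) ^ 2) :
    B.umin * (2 * (B.hmin - 4 * (κ₁ * (π * Real.sqrt 2 + 2 * B.smax) / (B.Dtmin - κ₁)) *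
        ((B.smax + κ₁ * (π * Real.sqrt 2 + 2 * B.smax) / (B.Dtmin - κ₁)) + B.smax)) -
        κ₂ * (B.smax + κ₁ * (π * Real.sqrt 2 + 2 * B.smax) / (B.Dtmin - κ₁)) ^ 2) /
        ((4 + κ₁) * (2 * (B.smax + κ₁ * (π * Real.sqrt 2 + 2 * B.smax) / (B.Dtmin - κ₁))) ^ 3) ≤
      (u θ ^ 2 + 2 * deriv u θ ^ 2 - u θ * deriv (deriv u) θ) / Real.sqrt (deriv u θ ^ 2 + u θ ^ 2) ^ 3 := by
  set SE := B.smax + κ₁ * (π * Real.sqrt 2 + 2 * B.smax) / (B.Dtmin - κ₁) with hSE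
  set M := B.umin * (2 * (B.hmin - 4 * (κ₁ * (π * Real.sqrt 2 + 2 * B.smax) / (B.Dtmin - κ₁)) * (SE + B.smax)) - κ₂ * SE ^ 2)
    with hM
  have hsq := abs_apply_le_pi_of_isBandFermiRadius (hu θ)
  have hκ₁0 : 0 ≤ κ₁ := le_trans (norm_nonneg _) (hκ _ hsq)
  have hN := curvatureNumerator_ge B hδs hδ hlo hhi hκ hκ₁ hκ₂ hu θ hpos
  have hsp := deriv_sq_add_sq_le B hδs hδ hlo hhi hκ hκ₁ hu θ
  have hM0 : 0 ≤ M := mul_nonneg B.umin_pos.le hpos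
  have hupos : 0 < u θ := (mem_Ioo_of_shifted B hδ hlo hhi (hu θ)).1
  have hs0 : 0 < Real.sqrt (deriv u θ ^ 2 + u θ ^ 2) := Real.sqrt_pos.2 (by positivity)
  have hSEpos : 0 < SE := by
    have h2ne : (2 : WithTop ℕ∞) ≠ 0 := by norm_num
    obtain ⟨hvx, hvy⟩ := abs_VXE_le B hδs h2ne hδ hlo hhi hκ hκ₁ hu θ
    have hv : VXE u θ ^ 2 + VYE u θ ^ 2 = deriv u θ ^ 2 + u θ ^ 2 := (deriv_sq_add_sq_eq_VXE u θ).symm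
    by_contra hle
    have hSE0 : SE ≤ 0 := le_of_not_gt hle
    have hx : VXE u θ = 0 := abs_nonpos_iff.1 (hvx.trans hSE0)
    have hy : VYE u θ = 0 := abs_nonpos_iff.1 (hvy.trans hSE0)
    rw [hx, hy] at hv
    nlinarith
  -- `√(u′² + u²) ≤ 2 S_E`
  have hsle : Real.sqrt (deriv u θ ^ 2 + u θ ^ 2) ≤ 2 * SE := by
    rw [Real.sqrt_le_left (by positivity)]
    nlinarith
  have hs3 : Real.sqrt (deriv u θ ^ 2 + u θ ^ 2) ^ 3 ≤ (2 * SE) ^ 3 :=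
    pow_le_pow_left₀ hs0.le hsle 3
  have hden : 0 < (4 + κ₁) * (2 * SE) ^ 3 := by positivity
  -- M/((4+κ₁)(2S_E)³) ≤ (M/(4+κ₁))/s³ ≤ N/s³
  calc M / ((4 + κ₁) * (2 * SE) ^ 3) = (M / (4 + κ₁)) / (2 * SE) ^ 3 := by rw [div_div]
    _ ≤ (M / (4 + κ₁)) / Real.sqrt (deriv u θ ^ 2 + u θ ^ 2) ^ 3 :=
        div_le_div_of_nonneg_left (div_nonneg hM0 (by linarith)) (pow_pos hs0 3) hs3
    _ ≤ (u θ ^ 2 + 2 * deriv u θ ^ 2 - u θ * deriv (deriv u) θ) / Real.sqrt (deriv u θ ^ 2 + u θ ^ 2) ^ 3 :=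
        div_le_div_of_nonneg_right hN (pow_pos hs0 3).le

end Curvature

end Summit.HubbardSuperconductivity.HubbardSuperconductivity.Theorems.PerturbedFermiCurve

end
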